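import Literature.FieldTheory.AlgClosed.PadicAlgClEquivComplex
import Literature.FieldTheory.AlgClosed.AutomorphismExtension
import HarnessLib

/-!
# `ℚ̄_p ≃ ℂ` COMPATIBLE with a given pair of embeddings of a countable field (Steinitz; proofs only)

Topic `FieldTheory/AlgClosed` (namespace `Literature.FieldTheory.AlgClosed`). THEOREMS ONLY (no definition, no named fact; D-0026).
Sequel of `PadicAlgClEquivComplex.lean` (`PadicAlgCl.nonempty_ringEquiv_complex`: SOME field isomorphism `ℚ̄_p ≃ ℂ`) and
`AutomorphismExtension.lean` (`exists_ringEquiv_apply_eq`: two embeddings of a countable field into an uncountable algebraically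
closed field differ by an automorphism): for a countable field `F` with embeddings `ι₁ : F → ℚ̄_p`, `ι₂ : F → ℂ` there is a field
isomorphism `e : ℚ̄_p ≃ ℂ` with `e ∘ ι₁ = ι₂`. This is the `ι : PadicAlgCl p ≃+* ℂ` with `ι (ι_g x) = x` quantified in the
erratum-road statements of cell `bsd-stepL` (e.g. `Theses.ErratumRoadFive.ErratumThm23SigmaLe`), now AVAILABLE inside proofs whose
binders carry only the `p`-adic embedding `ι_g : K_g → ℚ̄_p` (the corner stub (FIX) of crux 25505: it lets the proof invoke the
`ι`-indexed named facts `Hida2000_thm326_ordinary_unitRoot` and `Deligne1974_heckeT_eigenvalue_norm_le`).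

References: S. Lang, *Algebra*, GTM 211 (2002), Ch. VIII §1 (transcendence bases) and Ch. V §2 (extension of isomorphisms to
algebraic closures) [Lang2002]; D. Cox, *Primes of the form x² + ny²*, §10.C (the `Aut(ℂ)` argument) [Cox2013].
-/

noncomputable section

open Cardinal

namespace Literature.FieldTheory.AlgClosed

/-- **A field isomorphism `ℚ̄_p ≃ ℂ` compatible with given embeddings of a countable field**: for `#F ≤ ℵ₀`, `ι₁ : F →+* ℚ̄_p`,
`ι₂ : F →+* ℂ` there is `e : ℚ̄_p ≃+* ℂ` with `e (ι₁ x) = ι₂ x` (Steinitz: compose any `ℚ̄_p ≃ ℂ` with an automorphism of `ℂ`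
matching the two resulting embeddings of `F`). [cite: Lang2002, Ch. VIII §1 and Ch. V §2 (Steinitz: isomorphisms of algebraically closed fields of equal transcendence degree)] -/
theorem exists_padicAlgCl_ringEquiv_complex_apply_eq {p : ℕ} [Fact p.Prime] {F : Type} [Field F] (hF : #F ≤ ℵ₀)
    (ι₁ : F →+* PadicAlgCl p) (ι₂ : F →+* ℂ) : ∃ e : PadicAlgCl p ≃+* ℂ, ∀ x : F, e (ι₁ x) = ι₂ x := by
  obtain ⟨e₀⟩ := PadicAlgCl.nonempty_ringEquiv_complex p
  have hℂ : ℵ₀ < #ℂ := by rw [Cardinal.mk_complex]; exact aleph0_lt_continuum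
  obtain ⟨σ, hσ⟩ := exists_ringEquiv_apply_eq hℂ hF (e₀.toRingHom.comp ι₁) ι₂
  exact ⟨e₀.trans σ, fun x ↦ hσ x⟩

/-- The same for a field `F` that is finite-dimensional over `ℚ` (a number field is countable). [cite: Lang2002, Ch. VIII §1 and Ch. V §2] -/
theorem exists_padicAlgCl_ringEquiv_complex_apply_eq_of_finiteDimensional {p : ℕ} [Fact p.Prime] {F : Type} [Field F]
    [Algebra ℚ F] [FiniteDimensional ℚ F] (ι₁ : F →+* PadicAlgCl p) (ι₂ : F →+* ℂ) :
    ∃ e : PadicAlgCl p ≃+* ℂ, ∀ x : F, e (ι₁ x) = ι₂ x := by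
  refine exists_padicAlgCl_ringEquiv_complex_apply_eq ?_ ι₁ ι₂
  haveI : Countable F := by
    let b := Module.finBasis ℚ F
    exact Countable.of_equiv _ b.equivFun.toEquiv.symm
  exact Cardinal.mk_le_aleph0

end Literature.FieldTheory.AlgClosed

end
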